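import Literature.AnabelianGeometry.EtaleTheta.Discharge.Sec5Prop55GaloisLeafConnectedBase
import Literature.AnabelianGeometry.EtaleTheta.Discharge.Sec5Prop55SgpCupConjOfBiKummerData
import HarnessLib

/-!
# [EtTh] Prop. 5.5 at the assembled §5 data over the connected base `B^temp(Π^tp_X)⁰`: leaf (G) DISCHARGED and leaf `hcup` REDUCED
# to the Galois-equivariance of the root's bi-Kummer cocycle — the two reductions COMPOSED (abc-iut L2, rows #5-R43 + (R5) P55-L06c)

Mochizuki, *The étale theta function …*, Publ. RIMS **45** (2009), Prop. 5.5 pp.327–328 (PDF pp.101–102); Prop. 4.3 (iii) p.317 (PDF p.91)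
(the bi-Kummer difference `s^⊓-gp · (s^⊔-gp)⁻¹` is the Kummer class of the root) [cite: MochizukiEtTh2009, Prop 5.5 p.327–328 (PDF pp.101–102)];
Mochizuki, *Semi-graphs of anabelioids*, Publ. RIMS **42** (2006), Rmk. 3.1.3 p.34 [cite: MochizukiSemiAnbd2006, Rmk 3.1.3 p.34].

PROOF-ONLY (no definitions; seat abc-iut-w4-d099, cell abc-iut layer L2).  Composition BY NAME, as invited by abc-iut-L6-t23 (gen 4,
2026-08-26T05:59:13Z «R43: compose hgal/hproj with this by name»), of
* this seat's `ThetaFrobenioid.cyclotomicRigidity_ofBiKummerData_connectedPart` (`Sec5Prop55GaloisLeafConnectedBase.lean`, p425830: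
  abc-iut-w5-d020's `cyclotomicRigidity_ofBiKummerData_of_laws` with leaf (G) `hgal` DISCHARGED over `D := ConnectedPart (BTemp Π^tp_X)`), and
* abc-iut-L6-t23's `ThetaFrobenioid.hcup_iff_pull_root_mul` (`Sec5Prop55SgpCupConjOfBiKummerData.lean`, p425515: leaf `hcup` ⟺ the
  Galois-equivariance `hKR` of the pulled-back root `toB R.AN R.root` over `(l·Δ_Θ)`, given the [FrdI] Thm. 5.2 (ii) dictionary law `hfrac`),
into ONE statement `cyclotomicRigidity_ofBiKummerData_connectedPart_of_pullRoot`: [EtTh] Prop. 5.5 for the §5 data assembled over a §4 setting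
on the genuine connected base, with binder list `hIG hB P hη₀ hdies e he hlift hpre hP ν hK hσ hgeom hconst hreach hLc hLi hproj hfrac hKR` —
of abc-iut-w4-d008's three structural leaves only `hproj` (law on the FREE subquotient data `(Q, P)`, plan/GAP-LEDGER.md G-w4d099-2;
abc-iut-w4-d042's row at the genuine `(Q, P)`) remains.  Nothing restated; nothing of [EtTh] asserted; typed ≠ proved for the named binders;
no side taken on [IUTchIII] Cor. 3.12.
-/

noncomputable section

namespace Literature.AnabelianGeometry.EtaleTheta

open CategoryTheory Opposite FrobenioidCyclotomicRigidity Literature.AlgebraicGeometry.Frobenioids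
  Literature.AnabelianGeometry.SemiGraphs

universe u₀ v₀ w

namespace ThetaFrobenioid

variable {K : Type u₀} [Field K] {X : SemiGraphs.TemperedArithmeticGroup.{u₀} K} {D₀ : Type u₀} [Category.{v₀} D₀]
  {V : FrdIMonoidStub.{w}} {T₀ : RealifiedDivisorMonoids (D₀ := D₀) V}
  {VD : FrdICatStub.{u₀ + 1, u₀, w} (ConnectedPart (BTemp X.Pi))} {S : BiKummerSetting X T₀ (ConnectedPart (BTemp X.Pi)) VD}
  {pullFrac : ∀ {A A' : S.C} (_ : A' ⟶ A), S.biratUnits A → S.biratUnits A'}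
  {lv N : ℕ+} {l' : ℕ} {RD : RigidData.{max u₀ w} N l'} {θ : S.biratUnits S.Aodot} {Bl : S.C}
  {Pl : S.FractionPair θ Bl} {Rl : S.NthRoot θ Pl lv pullFrac}
  (h : ModelFrobenioid.Hypotheses S.tf.divisorMonoid S.tf.ratFnFunctor)
  (toB : ∀ A : S.C, S.biratUnits A →* S.tf.biratUnitsModel A)
  (Q : FrobenioidTheta.ThetaSubquotientStub.{w} (ConnectedPart (BTemp X.Pi)))
  (odd_l : Odd (lv : ℕ)) (R : S.NthRoot Rl.root Rl.pair N pullFrac) (ιX : RD.PiX ≃ₜ* X.Pi)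
  (hopen : IsOpen ((S.galoisSurj R.AN.base R.αData.isGalois).ker : Set X.Pi)) (σ : Aut R.AN.base →* Aut R.AN)
  (K' : Type w) [Field K'] (constEmb : K'ˣ →* S.tf.biratUnitsModel R.BN)
  (constEmb_injective : Function.Injective constEmb)
  (hdivc : ∀ g : Aut R.BN.base,
    ModelFrobenioid.div ((σ ((BiKummerSetting.NthRoot.baseIso S R).conjAut.symm g)).hom ≫ R.pair.num) =
      ModelFrobenioid.div R.pair.num)
  (hdivp : ∀ y : RD.PiYdd,
    ModelFrobenioid.div ((σ (S.galoisSurj R.AN.base R.αData.isGalois (ιX y.1))).hom ≫ R.pair.den) =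
      ModelFrobenioid.div R.pair.den)

/-- **[EtTh] Proposition 5.5 for the §5 data over the connected base `B^temp(Π^tp_X)⁰` — leaf (G) DISCHARGED, leaf `hcup` := the root's
bi-Kummer Galois-equivariance `hKR`** (composition of `cyclotomicRigidity_ofBiKummerData_connectedPart` with abc-iut-L6-t23's
`hcup_iff_pull_root_mul`): of the three structural leaves of `cyclotomicRigidity_of_laws` only `hproj` stays named.
[cite: MochizukiEtTh2009, Prop 5.5 p.327–328 (PDF pp.101–102)] -/
theorem cyclotomicRigidity_ofBiKummerData_connectedPart_of_pullRoot
    (hIG : ∀ A : ConnectedPart (BTemp X.Pi), S.IsGaloisObj A → SemiGraphs.IsGaloisObj A.obj)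
    (hB : (ofBiKummerData h toB Q odd_l R ιX hopen σ K' constEmb constEmb_injective hdivc hdivp).IsThetaSaturated
      (ofBiKummerData h toB Q odd_l R ιX hopen σ K' constEmb constEmb_injective hdivc hdivp).BN)
    (P : ThetaSubquotientProj (ofBiKummerData h toB Q odd_l R ιX hopen σ K' constEmb constEmb_injective hdivc hdivp))
    {η₀ : RD.PiYdd → RD.mu} (hη₀ : η₀ ∈ RD.thetaCocycles)
    (hdies : ∀ k : RD.PiYdd, rhoOfBiKummerData R ιX k = 1 → η₀ k = 1)
    (e : RD.mu → (ofBiKummerData h toB Q odd_l R ιX hopen σ K' constEmb constEmb_injective hdivc hdivp).lDeltaModN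
      (ofBiKummerData h toB Q odd_l R ιX hopen σ K' constEmb constEmb_injective hdivc hdivp).BN)
    (he : Function.Surjective e)
    (hlift : ∀ a ∈ (ofBiKummerData h toB Q odd_l R ιX hopen σ K' constEmb constEmb_injective hdivc hdivp).HB,
      a ∈ P.pre _ → ∃ k : RD.PiYdd, (k : RD.PiX) ∈ RD.lDeltaTheta ∧ rhoOfBiKummerData R ιX k = a)
    (hpre : ∀ k : RD.PiYdd, (k : RD.PiX) ∈ RD.lDeltaTheta → rhoOfBiKummerData R ιX k ∈ P.pre _)
    (hP : ∀ (k : RD.PiYdd) (hk : (k : RD.PiX) ∈ RD.lDeltaTheta) (hm : rhoOfBiKummerData R ιX k ∈ P.pre _),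
      (QuotientGroup.mk (P.proj _ ⟨rhoOfBiKummerData R ιX k, hm⟩) :
          (ofBiKummerData h toB Q odd_l R ιX hopen σ K' constEmb constEmb_injective hdivc hdivp).lDeltaModN
            (ofBiKummerData h toB Q odd_l R ιX hopen σ K' constEmb constEmb_injective hdivc hdivp).BN) =
        e (RD.thetaMod ⟨k, hk⟩))
    (ν : (ofBiKummerData h toB Q odd_l R ιX hopen σ K' constEmb constEmb_injective hdivc hdivp).lDeltaModN
        (ofBiKummerData h toB Q odd_l R ιX hopen σ K' constEmb constEmb_injective hdivc hdivp).BN ≃*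
      (ofBiKummerData h toB Q odd_l R ιX hopen σ K' constEmb constEmb_injective hdivc hdivp).muTorsion
        (ofBiKummerData h toB Q odd_l R ιX hopen σ K' constEmb constEmb_injective hdivc hdivp).BN
        (ofBiKummerData h toB Q odd_l R ιX hopen σ K' constEmb constEmb_injective hdivc hdivp).N)
    (hK : ∀ η : (ofBiKummerData h toB Q odd_l R ιX hopen σ K' constEmb constEmb_injective hdivc hdivp).HB →
        (ofBiKummerData h toB Q odd_l R ιX hopen σ K' constEmb constEmb_injective hdivc hdivp).lDeltaModN
          (ofBiKummerData h toB Q odd_l R ιX hopen σ K' constEmb constEmb_injective hdivc hdivp).BN,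
      (∀ k : RD.PiYdd, η ⟨rhoOfBiKummerData R ιX k, Subgroup.mem_map_of_mem _ k.2⟩ = e (η₀ k)) →
        FrobenioidThetaBiKummer.ThetaPairKummerClass
          (ofBiKummerData h toB Q odd_l R ιX hopen σ K' constEmb constEmb_injective hdivc hdivp) η ν)
    (hσ : ∀ g : Aut R.AN.base, ModelFrobenioid.baseMap (σ g).hom = g.hom)
    (hgeom : P.pre R.BN.base ≤ RD.aug.ker.map (rhoOfBiKummerData R ιX))
    (hconst : ∀ δ ∈ RD.aug.ker, ∀ τ : ModelFrobenioid.units R.BN,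
      (S.tf.ratFnFunctor.map (rhoOfBiKummerData R ιX δ).hom.op).hom (ModelFrobenioid.unit τ.1.hom) =
        ModelFrobenioid.unit τ.1.hom)
    (hreach : LinearlyReachableFromBN
      (ofBiKummerData h toB Q odd_l R ιX hopen σ K' constEmb constEmb_injective hdivc hdivp))
    (hLc : Thm56Sub.LDeltaMapComp
      (ofBiKummerData h toB Q odd_l R ιX hopen σ K' constEmb constEmb_injective hdivc hdivp))
    (hLi : Thm56Sub.LDeltaMapId
      (ofBiKummerData h toB Q odd_l R ιX hopen σ K' constEmb constEmb_injective hdivc hdivp))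
    -- the two structural leaves that stay NAMED at the data (laws on the free stub `Q` / `P`, and on `s^⊔-gp`)
    (hproj : ∀ (g g' : Aut ((ofBiKummerData h toB Q odd_l R ιX hopen σ K' constEmb constEmb_injective hdivc hdivp).base.obj
        (ofBiKummerData h toB Q odd_l R ιX hopen σ K' constEmb constEmb_injective hdivc hdivp).BN))
        (hh : g' ∈ P.pre _), ∃ hgh : g * g' * g⁻¹ ∈ P.pre _,
          (ofBiKummerData h toB Q odd_l R ιX hopen σ K' constEmb constEmb_injective hdivc hdivp).lDeltaMap g.hom
              (P.proj _ ⟨g', hh⟩) = P.proj _ ⟨g * g' * g⁻¹, hgh⟩)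
    -- P55-L06c (abc-iut-L6-t23): `hcup` REPLACED by the dictionary law of `toB` and the root's bi-Kummer Galois-equivariance
    (hfrac : ∀ {A B : S.C} (s' s'' : A ⟶ B) (h' : S.IsPreStep s') (h'' : S.IsPreStep s'')
      (hb : PreFrobenioid.BaseEquivalent S.F s' s''),
      (toB A (S.fracOf s' s'' h' h'' hb) : S.tf.ratFnFunctor.obj (op A.base)) *
        ModelFrobenioid.unit s'' = ModelFrobenioid.unit s')
    (hKR : ∀ (y₀ y : RD.PiX), y ∈ RD.PiYdd → rhoOfBiKummerData R ιX y ∈ P.pre R.BN.base →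
        pull S.tf.ratFnFunctor (S.galoisSurj R.AN.base R.αData.isGalois (ιX y)).hom
            (pull S.tf.ratFnFunctor (S.galoisSurj R.AN.base R.αData.isGalois (ιX y₀)).hom
              (toB R.AN R.root : S.tf.ratFnFunctor.obj (op R.AN.base))) *
            (toB R.AN R.root : S.tf.ratFnFunctor.obj (op R.AN.base)) =
          pull S.tf.ratFnFunctor (S.galoisSurj R.AN.base R.αData.isGalois (ιX y)).hom
              (toB R.AN R.root : S.tf.ratFnFunctor.obj (op R.AN.base)) *
            pull S.tf.ratFnFunctor (S.galoisSurj R.AN.base R.αData.isGalois (ιX y₀)).hom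
              (toB R.AN R.root : S.tf.ratFnFunctor.obj (op R.AN.base))) :
    CyclotomicRigidity (ofBiKummerData h toB Q odd_l R ιX hopen σ K' constEmb constEmb_injective hdivc hdivp) P hB :=
  cyclotomicRigidity_ofBiKummerData_connectedPart h toB Q odd_l R ιX hopen σ K' constEmb constEmb_injective hdivc hdivp hIG hB P hη₀
    hdies e he hlift hpre hP ν hK hσ hgeom hconst hreach hLc hLi hproj
    ((hcup_iff_pull_root_mul h toB Q odd_l R ιX hopen σ K' constEmb constEmb_injective hdivc hdivp hσ hfrac P).mpr hKR)

end ThetaFrobenioid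

end Literature.AnabelianGeometry.EtaleTheta

end
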